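import Literature.NumberTheory.Automorphic.CDTTheorem712
import Literature.NumberTheory.Automorphic.BCDTTheoremBWildAtThreeDet
import Literature.NumberTheory.EllipticCurves.ModFiveCongruenceHesseFamily
import Literature.NumberTheory.EllipticCurves.VariableChangePointsMap
import Literature.NumberTheory.EllipticCurves.WeilPairingProofs
import Literature.NumberTheory.EllipticCurves.DivisionField
import Literature.NumberTheory.EllipticCurves.GoodReductionUnramifiedProofs
import Literature.NumberTheory.GaloisRepresentations.AbsGaloisGroup
import Literature.NumberTheory.GaloisRepresentations.ChebotarevOpenSubgroup
import Literature.NumberTheory.GaloisRepresentations.QuadraticInertia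
import Literature.NumberTheory.DiophantineGeometry.LocalReductionFiniteBadPlacesProofs
import Literature.NumberTheory.EllipticCurves.ModPIrreducibleCongruenceTransferProofs
import Summits.ABC.ABC.Theorems.DefiniteXiFreyModularityStubAbsIrrNegThreeGroup
import Mathlib.NumberTheory.LSeries.PrimesInAP
import HarnessLib

/-!
# stub_switch — k3 GENERATION 5 companion: the extreme fibre `j = 1728`, atomised

Scratch sketch for `STUB-IDEAS-stub_switch-3.md` (gen 5).  NOT a proposal; every `sorry` below is a
PROPOSED HELPER LEMMA sized for ≤ 1 prover cycle.  Architecture, unchanged since gen 3/4 and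
kernel-checked there (`STUB_IDEAS_stub_switch_3g4_Sketch.lean`, namespace `…StubSwitchK3g4`, rc 0):

  `stub_switch  ⇐  thm132(i) [tree named fact] + Core1728 + FrobeniusCertificate (F2)`
  (`StubSwitchK3g4.stub_switch_of_core_and_tail`, PROVED), and
  `Core1728 ⇐ T0 + T1 + T2 + G4a + G4c + Thm132ii [named fact]` (`StubSwitchK3g3.exists_fixed_root_1728`
  + `StubSwitchK3g4.exists_root_C6_fixed_of_conj`, PROVED), `tail ⇐ G3 + G2 + N3 (PROVED) + F2`.

What gen 5 adds (this file): the four remaining M-sized helpers are CUT into S/XS statements over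
existing tree API, each with its one-line recipe —
* §1 TW  transport of the Galois action through a twist defined over `ℚ̄` (one general lemma over
  the tree's `VariableChange.pointEquiv` + `Affine.Point.congrEquiv`) and NEG (`u ↦ -u` is `-1`);
  T1 (quadratic twist `E₉`) and T2 (quartic twist `E₋₃`) become corollaries.
* §2 W1–W3  frames ⇒ symplectic `σ`-equivariant `e : E'[5] ≃ E[5]` (G4a PROVED from them below).
* §3 G3a/G3b/G3c (+ R1, R2, R5, polynomial bookkeeping N4/N6): Chebotarev ⇒ a prime `ℓ ≡ 5 (12)`
  and an INTEGER root `t` of `𝔠₆ (mod ℓ)` off the cusps (G3 PROVED from them below).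
* §4 T0 = a six-step recipe over named tree lemmas (inertia at `3` moving `√3`, `χ₂₀` unramified
  at `3`, Néron–Ogg–Shafarevich for `E₁ : y² = x³ + x` at `3`).
-/

noncomputable section

open scoped Classical NumberField

namespace Summit.ABC.ABC.Cruxes.FreyModularity.StubSwitchK3g5

open Literature.NumberTheory.EllipticCurves Literature.NumberTheory.EllipticCurves.HesseFamilyFive
open Literature.NumberTheory.Automorphic Literature.NumberTheory.GaloisRepresentations
open Literature.NumberTheory.Automorphic.BCDT WeierstrassCurve IsDedekindDomain Field

universe u

/-! ## §0 Context (verbatim g3/g4) -/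

/-- The member `E_{λ,μ} : y² = x³ − 27𝔠₄(λ,μ)x − 54𝔠₆(λ,μ)` of Fisher's direct Hesse family. -/
abbrev member (c₄ c₆ l m : ℚ) : WeierstrassCurve ℚ :=
  ⟨0, 0, 0, -27 * C4 c₄ c₆ l m, -54 * C6 c₄ c₆ l m⟩

/-- The `c₄c₆`-model `y² = x³ − 27c₄x − 54c₆`. -/
abbrev base (c₄ c₆ : ℚ) : WeierstrassCurve ℚ := ⟨0, 0, 0, -27 * c₄, -54 * c₆⟩

/-- `E₁ : y² = x³ + x` (`j = 1728`, conductor `64`, good at `3`, `Δ = -64`). -/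
abbrev E₁ : WeierstrassCurve ℚ := ⟨0, 0, 0, 1, 0⟩
/-- `E₉ : y² = x³ + 9x`, the quadratic twist of `E₁` by `√-3` (`u⁻¹ = s`, `s² = -3`). -/
abbrev E₉ : WeierstrassCurve ℚ := ⟨0, 0, 0, 9, 0⟩
/-- `E₋₃ : y² = x³ − 3x`, the quartic twist of `E₁` (`u⁻¹ = w`, `w⁴ = -3`). -/
abbrev Em₃ : WeierstrassCurve ℚ := ⟨0, 0, 0, -3, 0⟩

instance : E₁.IsElliptic :=
  ⟨isUnit_iff_ne_zero.mpr (by norm_num [E₁, WeierstrassCurve.Δ, WeierstrassCurve.b₂,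
    WeierstrassCurve.b₄, WeierstrassCurve.b₆, WeierstrassCurve.b₈])⟩
instance : E₉.IsElliptic :=
  ⟨isUnit_iff_ne_zero.mpr (by norm_num [E₉, WeierstrassCurve.Δ, WeierstrassCurve.b₂,
    WeierstrassCurve.b₄, WeierstrassCurve.b₆, WeierstrassCurve.b₈])⟩
instance : Em₃.IsElliptic :=
  ⟨isUnit_iff_ne_zero.mpr (by norm_num [Em₃, WeierstrassCurve.Δ, WeierstrassCurve.b₂,
    WeierstrassCurve.b₄, WeierstrassCurve.b₆, WeierstrassCurve.b₈])⟩

/-- The gen-3/4 CORE (verbatim g4). -/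
def Core1728 : Prop :=
  ∀ (c₄ c₆ : ℤ), c₄ ^ 3 ≠ c₆ ^ 2 → c₆ ≠ 0 →
    ∃ (τ : Field.absoluteGaloisGroup ℚ) (t₁ : AlgebraicClosure ℚ),
      (∀ s : AlgebraicClosure ℚ, s ^ 2 = -3 → τ • s = -s) ∧
      (∀ z : AlgebraicClosure ℚ, z ^ 4 = 1 → τ • z = z) ∧
      C6 (c₄ : AlgebraicClosure ℚ) c₆ t₁ 1 = 0 ∧ C4 (c₄ : AlgebraicClosure ℚ) c₆ t₁ 1 ≠ 0 ∧
      τ • t₁ = t₁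

/-! ## §1 TW — transport of the Galois action through a twist over `L` (cuts T1, T2)

The tree has the RATIONAL case (`VariableChange.pointEquivBaseChange_map_algEquiv`: a change of
variables defined over `F` commutes with `σ`).  A twist `C` is defined over `L = ℚ̄` only, but its
target `W'` is defined over `F`; then `σ` transports `ψ_C` to `ψ_{σC}`:  `σ (ψ_C P) = ψ_{σC} (σ P)`,
both read in `W'(L)` through `Affine.Point.congrEquiv`.  Coordinates: `σ (u⁻²(x−r)) = (σu)⁻²(σx − σr)`. -/

section Transport

variable {F : Type u} [Field F] {L : Type u} [Field L] [Algebra F L]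

/-- TW0 (XS): the `σ`-conjugate change of variables has the same (rational) target:
apply `WeierstrassCurve.map σ` to `h` (`map_variableChange`, `map_baseChange`). [folklore] -/
theorem map_smul_baseChange_eq (W W' : WeierstrassCurve F) (C : VariableChange L) (σ : L ≃ₐ[F] L)
    (h : C • W.baseChange L = W'.baseChange L) :
    (C.map (σ : L →+* L)) • W.baseChange L = W'.baseChange L := by
  sorry

/-- **TW (M−): Galois transport through a twist.**  For `C : VariableChange L` with
`C • W_L = W'_L` (`W, W'` over `F`) and `σ ∈ Aut(L/F)`:
`σ • (congr h (ψ_C P)) = congr hσ (ψ_{σC} (σ • P))` in `W'(L)`.  Proof: cases on `P`;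
`pointEquiv_some`, `congrEquiv_some`, `smul_def`/`Affine.Point.map_some`, then
`toX_def/toY_def` + `map_mul, map_pow, map_sub, map_inv₀` (cf. tree `map_toX/map_toY`).
[SilvermanAEC2009 X.2 (twists), III.1; folklore] -/
theorem smul_congrEquiv_pointEquiv (W W' : WeierstrassCurve F) (C : VariableChange L)
    (σ : L ≃ₐ[F] L) (h : C • W.baseChange L = W'.baseChange L)
    (hσ : (C.map (σ : L →+* L)) • W.baseChange L = W'.baseChange L)
    (P : (W.baseChange L).toAffine.Point) :
    σ • (Affine.Point.congrEquiv h (VariableChange.pointEquiv (W.baseChange L) C P)) =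
      Affine.Point.congrEquiv hσ
        (VariableChange.pointEquiv (W.baseChange L) (C.map (σ : L →+* L)) (σ • P)) := by
  sorry

/-- **NEG (S): `u ↦ -u` acts as `-1`.**  For `V` with `a₁ = a₃ = 0` (so `negY = -y`), the scalings by
`u` and `-u` have the same target and differ by negation: `((-u)⁻²x, (-u)⁻³y) = (u⁻²x, -u⁻³y)`.
Cases on `P`; `pointEquiv_some`, `congrEquiv_some`, `Affine.Point.neg_some`, `Affine.negY`. [folklore] -/
theorem congrEquiv_pointEquiv_neg (V V' : WeierstrassCurve L) (h₁ : V.a₁ = 0) (h₃ : V.a₃ = 0)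
    (u : Lˣ) (h : (⟨u, 0, 0, 0⟩ : VariableChange L) • V = V')
    (h' : (⟨-u, 0, 0, 0⟩ : VariableChange L) • V = V') (P : V.toAffine.Point) :
    Affine.Point.congrEquiv h' (VariableChange.pointEquiv V ⟨-u, 0, 0, 0⟩ P) =
      -Affine.Point.congrEquiv h (VariableChange.pointEquiv V ⟨u, 0, 0, 0⟩ P) := by
  sorry

/-- NEG0 (XS): pure scalings by `u` and `-u` give the same equation when `a₁ = a₃ = 0`
(`variableChange_a₂/_a₄/_a₆`: even powers of `u`; `_a₁/_a₃` vanish). [folklore] -/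
theorem neg_scaling_smul_eq (V : WeierstrassCurve L) (h₁ : V.a₁ = 0) (h₃ : V.a₃ = 0) (u : Lˣ) :
    (⟨-u, 0, 0, 0⟩ : VariableChange L) • V = (⟨u, 0, 0, 0⟩ : VariableChange L) • V := by
  sorry

end Transport

/-- BRIDGE (rfl, checked): the `Γ_ℚ`-action on `geomPoints W` IS the `AlgEquiv`-action on `W(ℚ̄)`,
i.e. `Affine.Point.map ↑τ` — this is how T1/T2 provers connect `τ • P` to TW's statement. -/
example (W : WeierstrassCurve ℚ) (τ : Field.absoluteGaloisGroup ℚ) (P : W.geomPoints) :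
    (show (W.baseChange (AlgebraicClosure ℚ)).toAffine.Point from τ • P) =
      (show AlgebraicClosure ℚ ≃ₐ[ℚ] AlgebraicClosure ℚ from τ) •
        (show (W.baseChange (AlgebraicClosure ℚ)).toAffine.Point from P) := rfl

example (W : WeierstrassCurve ℚ) (τ : Field.absoluteGaloisGroup ℚ) (P : W.geomPoints) :
    (show (W.baseChange (AlgebraicClosure ℚ)).toAffine.Point from τ • P) =
      Affine.Point.map ((show AlgebraicClosure ℚ ≃ₐ[ℚ] AlgebraicClosure ℚ from τ) :
        AlgebraicClosure ℚ →ₐ[ℚ] AlgebraicClosure ℚ)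
        (show (W.baseChange (AlgebraicClosure ℚ)).toAffine.Point from P) := rfl

/-- T1-data (XS): the quadratic twist `E₁ → E₉` over `ℚ̄`: `u⁻¹ = s`, `s² = -3` (`s⁴ = 9`). -/
theorem twist_E₉ (s : AlgebraicClosure ℚ) (hs : s ^ 2 = -3) (hs0 : s ≠ 0) :
    (⟨(Units.mk0 s hs0)⁻¹, 0, 0, 0⟩ : VariableChange (AlgebraicClosure ℚ)) •
        E₁.baseChange (AlgebraicClosure ℚ) = E₉.baseChange (AlgebraicClosure ℚ) := by
  sorry

/-- T2-data (XS): the quartic twist `E₁ → E₋₃` over `ℚ̄`: `u⁻¹ = w`, `w⁴ = -3`. -/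
theorem twist_Em₃ (w : AlgebraicClosure ℚ) (hw : w ^ 4 = -3) (hw0 : w ≠ 0) :
    (⟨(Units.mk0 w hw0)⁻¹, 0, 0, 0⟩ : VariableChange (AlgebraicClosure ℚ)) •
        E₁.baseChange (AlgebraicClosure ℚ) = Em₃.baseChange (AlgebraicClosure ℚ) := by
  sorry

/-- **T1 (S from TW + NEG):** `τ` negating `√-3` and trivial on `E₁[5]` acts as `-1` on `E₉[5]`.
Recipe: `ψ := congrEquiv (twist_E₉ s) ∘ pointEquiv _ C`, `C = ⟨(mk0 s)⁻¹,0,0,0⟩`; `ψ` is additive and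
bijective so `E₉[5] = ψ(E₁[5])`; for `Q = ψ P`: TW gives `τ Q = congr _ (ψ_{τC} (τ P))` with `τ P = P`
and `τC = ⟨(mk0 (τ s))⁻¹,…⟩ = ⟨-(mk0 s)⁻¹, 0,0,0⟩` (`τ s = -s`, `Units.map`), so NEG gives `τ Q = -Q`. -/
theorem smul_torsion_E₉ (τ : Field.absoluteGaloisGroup ℚ)
    (hs : ∀ s : AlgebraicClosure ℚ, s ^ 2 = -3 → τ • s = -s)
    (h₁ : ∀ P : E₁.geomTorsion 5, τ • P = P) :
    ∀ P : E₉.geomTorsion 5, τ • P = -P := by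
  sorry

/-- **T2 (S from TW twice + NEG):** `τ` negating `√-3`, fixing `μ₄`, trivial on `E₁[5]` has
`τ² = -1` on `E₋₃[5]`.  Recipe: `C = ⟨(mk0 w)⁻¹,0,0,0⟩`, `w⁴ = -3`; `τ w = ζ w` with `ζ⁴ = 1`
(`(τw)⁴ = -3`), `ζ² = τ(w²)/w² = -1` (`w²` is a square root of `-3`), `τ ζ = ζ`; TW twice:
`τ²(ψ_C P) = congr _ (ψ_{τ²C} P)` with `τ²C = ⟨(mk0 (ζ²w))⁻¹,…⟩ = ⟨-(mk0 w)⁻¹,0,0,0⟩`; NEG. -/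
theorem smul_smul_torsion_Em₃ (τ : Field.absoluteGaloisGroup ℚ)
    (hs : ∀ s : AlgebraicClosure ℚ, s ^ 2 = -3 → τ • s = -s)
    (hi : ∀ z : AlgebraicClosure ℚ, z ^ 4 = 1 → τ • z = z)
    (h₁ : ∀ P : E₁.geomTorsion 5, τ • P = P) :
    ∀ P : Em₃.geomTorsion 5, τ • (τ • P) = -P := by
  sorry

/-! ## §2 W1–W3 — frames ⇒ a symplectic `σ`-equivariant isomorphism (cuts G4a) -/

/-- the determinant form on `𝔽₅²` -/
def det2 (u v : Fin 2 → ZMod 5) : ZMod 5 := u 0 * v 1 - u 1 * v 0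

/-- **W1 (M−): the Weil pairing in a frame is `ζ^{det}`.**  `g₁ = e₁⁻¹(1,0)`, `g₂ = e₁⁻¹(0,1)`,
`ζ := e₅(g₁,g₂)` is a PRIMITIVE 5th root (non-degeneracy `eq_zero_of_weilPairingFun_eq_one` + `g₂ ≠ 0`),
and bilinearity/alternation (`weilPairingFun_add_left/_add_right/_self/_pow`) give
`e₅(P,Q) = ζ^{ad−bc}`.  TEMPLATE = tree PROVED
`WeilPairingCyclicComponents.intCast_mul_eq_modNCyclotomicCharacter_of_smul_eq_zsmul` (same bookkeeping).
[SilvermanAEC2009 III.8.1; SilvermanCSS1997 II §7–8] -/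
theorem weilPairing_eq_pow_det_of_frame (E : WeierstrassCurve ℚ) [E.IsElliptic]
    (e₁ : E.geomTorsion 5 ≃+ (Fin 2 → ZMod 5)) :
    ∃ ζ : AlgebraicClosure ℚ, IsPrimitiveRoot ζ 5 ∧
      ∀ P Q : E.geomTorsion 5,
        weilPairingFun (W := E) (m := 5) (by norm_num) (P : E.geomPoints) Q =
          ζ ^ (det2 (e₁ P) (e₁ Q)).val := by
  sorry

/-- W2 (XS): two primitive 5th roots of unity are unit powers of each other
(`IsPrimitiveRoot.eq_pow_of_pow_eq_one`, `IsPrimitiveRoot.pow_iff_coprime`). [folklore] -/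
theorem exists_unit_pow_eq {ζ ζ' : AlgebraicClosure ℚ} (hζ : IsPrimitiveRoot ζ 5)
    (hζ' : IsPrimitiveRoot ζ' 5) : ∃ k : (ZMod 5)ˣ, ζ' = ζ ^ ((k : ZMod 5)).val := by
  sorry

/-- W3a (XS): the additive isomorphism `e := e₁⁻¹ ∘ C ∘ e₁'` (`Matrix.GeneralLinearGroup.toLin` /
`toLinear`, `.toAddEquiv`). [folklore] -/
theorem exists_addEquiv_of_gl {E E' : WeierstrassCurve ℚ} (e₁ : E.geomTorsion 5 ≃+ (Fin 2 → ZMod 5))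
    (e₁' : E'.geomTorsion 5 ≃+ (Fin 2 → ZMod 5)) (C : GL (Fin 2) (ZMod 5)) :
    ∃ e : E'.geomTorsion 5 ≃+ E.geomTorsion 5,
      ∀ P, e₁ (e P) = Matrix.mulVec (C : Matrix (Fin 2) (Fin 2) (ZMod 5)) (e₁' P) := by
  sorry

/-- W3b (S): `C ρ̄'(σ) = ρ̄(σ) C` makes `e = e₁⁻¹ C e₁'` equivariant at `σ`
(`Matrix.mulVec_mulVec`, injectivity of `e₁`). [folklore] -/
theorem equivariant_of_conj {E E' : WeierstrassCurve ℚ} {ρ ρ' : ModPGaloisRep ℚ (ZMod 5) 2}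
    {e₁ : E.geomTorsion 5 ≃+ (Fin 2 → ZMod 5)} {e₁' : E'.geomTorsion 5 ≃+ (Fin 2 → ZMod 5)}
    (hρ : ∀ (σ : Field.absoluteGaloisGroup ℚ) (P : E.geomTorsion 5),
      e₁ (σ • P) = Matrix.mulVec ((ρ σ : GL (Fin 2) (ZMod 5)) : Matrix (Fin 2) (Fin 2) (ZMod 5)) (e₁ P))
    (hρ' : ∀ (σ : Field.absoluteGaloisGroup ℚ) (P : E'.geomTorsion 5),
      e₁' (σ • P) = Matrix.mulVec ((ρ' σ : GL (Fin 2) (ZMod 5)) : Matrix (Fin 2) (Fin 2) (ZMod 5)) (e₁' P))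
    {C : GL (Fin 2) (ZMod 5)} {e : E'.geomTorsion 5 ≃+ E.geomTorsion 5}
    (he : ∀ P, e₁ (e P) = Matrix.mulVec (C : Matrix (Fin 2) (Fin 2) (ZMod 5)) (e₁' P))
    (σ : Field.absoluteGaloisGroup ℚ) (hC : C * ρ' σ = ρ σ * C) :
    ∀ P : E'.geomTorsion 5, e (σ • P) = σ • e P := by
  sorry

/-- W3c (S): with `det C = k` and `ζ_{E'} = ζ_E^k`, `e = e₁⁻¹ C e₁'` preserves the Weil pairing:
`det2 (C u) (C v) = det C · det2 u v` (`Matrix.det_fin_two`, `mulVec`), exponents `mod 5`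
(`ZMod.val_mul`, `pow_eq_pow_mod`, `ζ⁵ = 1`). [Fisher2012Hessian Def 13.1; folklore] -/
theorem weil_compat_of_det_eq {E E' : WeierstrassCurve ℚ} [E.IsElliptic] [E'.IsElliptic]
    {e₁ : E.geomTorsion 5 ≃+ (Fin 2 → ZMod 5)} {e₁' : E'.geomTorsion 5 ≃+ (Fin 2 → ZMod 5)}
    {ζ ζ' : AlgebraicClosure ℚ} (hζ5 : ζ ^ 5 = 1)
    (hw : ∀ P Q : E.geomTorsion 5,
      weilPairingFun (W := E) (m := 5) (by norm_num) (P : E.geomPoints) Q = ζ ^ (det2 (e₁ P) (e₁ Q)).val)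
    (hw' : ∀ P Q : E'.geomTorsion 5,
      weilPairingFun (W := E') (m := 5) (by norm_num) (P : E'.geomPoints) Q = ζ' ^ (det2 (e₁' P) (e₁' Q)).val)
    {k : (ZMod 5)ˣ} (hk : ζ' = ζ ^ ((k : ZMod 5)).val) {C : GL (Fin 2) (ZMod 5)}
    (hdet : Matrix.GeneralLinearGroup.det C = k) {e : E'.geomTorsion 5 ≃+ E.geomTorsion 5}
    (he : ∀ P, e₁ (e P) = Matrix.mulVec (C : Matrix (Fin 2) (Fin 2) (ZMod 5)) (e₁' P)) :
    ∀ P Q : E'.geomTorsion 5,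
      weilPairingFun (W := E) (m := 5) (by norm_num) (e P : E.geomPoints) (e Q) =
        weilPairingFun (W := E') (m := 5) (by norm_num) (P : E'.geomPoints) Q := by
  sorry

/-- **G4a (PROVED from W1, W2, W3a–c)** — g4's `exists_symplectic_equivariant_at`
(its `σ ∈ eqvSubgroup e` is `mem_eqvSubgroup_iff`-equal to the equivariance clause here). -/
theorem exists_symplectic_equivariant_at (E E' : WeierstrassCurve ℚ) [E.IsElliptic] [E'.IsElliptic]
    (ρ ρ' : ModPGaloisRep ℚ (ZMod 5) 2) (hρ : E.IsTorsionGaloisRep 5 ρ)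
    (hρ' : E'.IsTorsionGaloisRep 5 ρ') (σ : Field.absoluteGaloisGroup ℚ)
    (hconj : ∀ k : (ZMod 5)ˣ, ∃ C : GL (Fin 2) (ZMod 5),
      Matrix.GeneralLinearGroup.det C = k ∧ C * ρ' σ = ρ σ * C) :
    ∃ e : E'.geomTorsion 5 ≃+ E.geomTorsion 5, (∀ P : E'.geomTorsion 5, e (σ • P) = σ • e P) ∧
      ∀ P Q : E'.geomTorsion 5,
        weilPairingFun (W := E) (m := 5) (by norm_num) (e P : E.geomPoints) (e Q) =
          weilPairingFun (W := E') (m := 5) (by norm_num) (P : E'.geomPoints) Q := by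
  obtain ⟨e₁, he₁⟩ := hρ
  obtain ⟨e₁', he₁'⟩ := hρ'
  obtain ⟨ζ, hζ, hw⟩ := weilPairing_eq_pow_det_of_frame E e₁
  obtain ⟨ζ', hζ', hw'⟩ := weilPairing_eq_pow_det_of_frame E' e₁'
  obtain ⟨k, hk⟩ := exists_unit_pow_eq hζ hζ'
  obtain ⟨C, hdet, hC⟩ := hconj k
  obtain ⟨e, he⟩ := exists_addEquiv_of_gl e₁ e₁' C
  exact ⟨e, equivariant_of_conj he₁ he₁' he σ hC, weil_compat_of_det_eq hζ.pow_eq_one hw hw' hk hdet he⟩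

/-! ## §3 G3 atomised — Chebotarev, `ℓ ≡ 5 (12)`, and an INTEGER root of `𝔠₆ (mod ℓ)` -/

/-- **G3a (S/M−): Chebotarev with prescribed Frobenius.**  `N :=` the fixing subgroup of the normal
closure of `ℚ(t₁, ζ)` (finite Galois: `N` open — `IntermediateField.fixingSubgroup_isOpen` — and
normal — `InfiniteGalois.normal_iff_isGalois`); tree PROVED `exists_isArithFrobAt_mul_inv_mem_not_mem`
with `S' := primesEquiv.symm '' S` gives `v ∉ S'`, `𝔓 ∣ v`, `φ` Frobenius with `φ σ⁻¹ ∈ N`, whence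
`φ t₁ = σ t₁ = t₁`, `φ ζ = σ ζ = ζ⁵`; `ℓ := primesEquiv v` (`natCast_mem_asIdeal_iff_eq_primesEquiv_symm`).
[NeukirchANT1999 VII.13.4; TateGCFT1967 §2.4] -/
theorem exists_frob_fixing (t₁ ζ : AlgebraicClosure ℚ) (σ : Field.absoluteGaloisGroup ℚ)
    (hσt : σ • t₁ = t₁) (hσζ : σ • ζ = ζ ^ 5) (S : Finset ℕ) :
    ∃ ℓ : ℕ, ℓ.Prime ∧ ℓ ∉ S ∧ ∃ v : HeightOneSpectrum (𝓞 ℚ), (ℓ : 𝓞 ℚ) ∈ v.asIdeal ∧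
      ∃ 𝔓 ∈ v.primesAbove, ∃ φ : Field.absoluteGaloisGroup ℚ,
        IsArithFrobAt (𝓞 ℚ) φ 𝔓 ∧ φ • t₁ = t₁ ∧ φ • ζ = ζ ^ 5 := by
  sorry

/-- **G3b (S): `φ ζ₁₂ = ζ₁₂⁵ ⇒ ℓ ≡ 5 (mod 12)`.**  Tree PROVED
`Rat.modNCyclotomicCharacter_of_isArithFrobAt` (`χ₁₂(φ) = ℓ`, needs `ℓ ∤ 12`) and
`modNCyclotomicCharacter_spec ℚ 12 φ ζ` (`φ ζ = ζ^{χ₁₂(φ)}`); `IsPrimitiveRoot.pow_inj`. [folklore] -/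
theorem mod_twelve_of_frob {ℓ : ℕ} (hℓ : ℓ.Prime) (h2 : ℓ ≠ 2) (h3 : ℓ ≠ 3)
    {v : HeightOneSpectrum (𝓞 ℚ)} (hv : (ℓ : 𝓞 ℚ) ∈ v.asIdeal)
    {𝔓 : Ideal (absIntegers (𝓞 ℚ) ℚ)} (h𝔓 : 𝔓 ∈ v.primesAbove) {φ : Field.absoluteGaloisGroup ℚ}
    (hφ : IsArithFrobAt (𝓞 ℚ) φ 𝔓) {ζ : AlgebraicClosure ℚ} (hζ : IsPrimitiveRoot ζ 12)
    (hφζ : φ • ζ = ζ ^ 5) : ℓ % 12 = 5 := by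
  sorry

/-- R1 (XS): an integral multiple of an algebraic number is an algebraic integer
(`Algebra.IsAlgebraic ℚ ℚ̄`, `IsAlgebraic.exists_integral_multiple`, `mem_integralClosure_iff`,
`IsIntegral.tower_top`). [folklore] -/
theorem exists_nat_mul_mem_absIntegers (t : AlgebraicClosure ℚ) :
    ∃ d : ℕ, 0 < d ∧ (d : AlgebraicClosure ℚ) * t ∈ absIntegers (𝓞 ℚ) ℚ := by
  sorry

/-- **R2 (S/M−): a Frobenius-fixed algebraic integer is congruent to a rational integer.**
`φ x ≡ x^ℓ (mod 𝔓)` (`isArithFrobAt_iff_of_mem_primesAbove`, `Rat.residueCard_eq_of_natCast_mem`) and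
`φ x = x` give `x̄^ℓ = x̄` in the field `ℤ̄/𝔓` (`isMaximal_of_mem_primesAbove`) of characteristic `ℓ`;
`X^ℓ − X` has at most `ℓ` roots (`Polynomial.card_roots'`) and the `ℓ` classes of `ℤ` are roots
(`ZMod.pow_card`), so `x̄ = n̄`. [NeukirchANT1999 I §8; folklore] -/
theorem exists_int_sub_mem_of_frob_fixed {ℓ : ℕ} (hℓ : ℓ.Prime) {v : HeightOneSpectrum (𝓞 ℚ)}
    (hv : (ℓ : 𝓞 ℚ) ∈ v.asIdeal) {𝔓 : Ideal (absIntegers (𝓞 ℚ) ℚ)} (h𝔓 : 𝔓 ∈ v.primesAbove)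
    {φ : Field.absoluteGaloisGroup ℚ} (hφ : IsArithFrobAt (𝓞 ℚ) φ 𝔓) {x : AlgebraicClosure ℚ}
    (hx : x ∈ absIntegers (𝓞 ℚ) ℚ) (hφx : φ • x = x) :
    ∃ n : ℤ, (⟨x, hx⟩ : absIntegers (𝓞 ℚ) ℚ) - (n : absIntegers (𝓞 ℚ) ℚ) ∈ 𝔓 := by
  sorry

/-- R5 (S): a nonzero algebraic integer lies in only finitely many rational primes' fibres:
if `x ∈ 𝔓` then the constant coefficient `a₀` of `minpoly ℤ x` lies in `𝔓`
(`Polynomial.X_mul_divX_add`: `a₀ = −x · (divX p)(x)`, `minpoly.aeval`); and `a₀ ≠ 0` for `x ≠ 0`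
(`minpoly.coeff_zero_ne_zero`).  With `ℓ ∈ 𝔓`, `ℓ ∤ a₀`, Bézout gives `1 ∈ 𝔓`. [folklore] -/
theorem coeff_zero_minpoly_mem {x : AlgebraicClosure ℚ} (hx : x ∈ absIntegers (𝓞 ℚ) ℚ)
    {𝔓 : Ideal (absIntegers (𝓞 ℚ) ℚ)} (hmem : (⟨x, hx⟩ : absIntegers (𝓞 ℚ) ℚ) ∈ 𝔓) :
    (((minpoly ℤ x).coeff 0 : ℤ) : absIntegers (𝓞 ℚ) ℚ) ∈ 𝔓 := by
  sorry

section HessePolynomials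

variable {R : Type*} [CommRing R]

/-- integral numerator of `𝔠₄`: `𝔠₄ = N4 / 17424` (degree `20` in `(l,m)`). [Fisher2012Hessian §8] -/
def N4 (c₄ c₆ l m : R) : R := -(Dll c₄ c₆ l m * Dmm c₄ c₆ l m - Dlm c₄ c₆ l m ^ 2)
/-- integral numerator of `∂𝔠₄/∂λ`. -/
def N4l (c₄ c₆ l m : R) : R :=
  -(Dlll c₄ c₆ l m * Dmm c₄ c₆ l m + Dll c₄ c₆ l m * Dlmm c₄ c₆ l m
    - 2 * Dlm c₄ c₆ l m * Dllm c₄ c₆ l m)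
/-- integral numerator of `∂𝔠₄/∂μ`. -/
def N4m (c₄ c₆ l m : R) : R :=
  -(Dllm c₄ c₆ l m * Dmm c₄ c₆ l m + Dll c₄ c₆ l m * Dmmm c₄ c₆ l m
    - 2 * Dlm c₄ c₆ l m * Dlmm c₄ c₆ l m)
/-- integral numerator of `𝔠₆`: `240 · 17424 · 𝔠₆ = N6` (degree `30` in `(l,m)`). [Fisher2012Hessian §8] -/
def N6 (c₄ c₆ l m : R) : R := Dl c₄ c₆ l m * N4m c₄ c₆ l m - Dm c₄ c₆ l m * N4l c₄ c₆ l m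

end HessePolynomials

/-- P1 (XS): `𝔠₄ = N4/17424`, `240·17424·𝔠₆ = N6` in a field with `2·3·5·11 ≠ 0`
(`unfold C4 C6 C4l C4m N4 N6 …; field_simp; ring`). -/
theorem C4_C6_eq_N {F : Type*} [Field F] (h17424 : (17424 : F) ≠ 0) (h240 : (240 : F) ≠ 0)
    (c₄ c₆ l m : F) :
    C4 c₄ c₆ l m = N4 c₄ c₆ l m / 17424 ∧ (240 * 17424 : F) * C6 c₄ c₆ l m = N6 c₄ c₆ l m := by
  sorry

/-- P2 (S, `ring` after `unfold`): homogeneity of `N4` (degree `20`) and `N6` (degree `30`). -/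
theorem N4_N6_smul {R : Type*} [CommRing R] (c₄ c₆ k l m : R) :
    N4 c₄ c₆ (k * l) (k * m) = k ^ 20 * N4 c₄ c₆ l m ∧
      N6 c₄ c₆ (k * l) (k * m) = k ^ 30 * N6 c₄ c₆ l m := by
  sorry

/-- P3 (XS, `simp [N4, N6, Dl, …, map_add, map_mul, map_pow, map_sub, map_neg, map_ofNat]`):
`N4, N6` commute with ring homomorphisms. -/
theorem map_N4_N6 {R R' : Type*} [CommRing R] [CommRing R'] (f : R →+* R') (c₄ c₆ l m : R) :
    f (N4 c₄ c₆ l m) = N4 (f c₄) (f c₆) (f l) (f m) ∧ f (N6 c₄ c₆ l m) = N6 (f c₄) (f c₆) (f l) (f m) := by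
  sorry

/-- **G3c (S given R1, R2, R5, P1–P3; M− directly): the reduction of a Frobenius-fixed root is an
INTEGER root off the cusps.**  `S₀ :=` primes of `2·3·5·11·d·a₀` where `x = d t₁ ∈ ℤ̄` (R1) and
`a₀ = (minpoly ℤ y).coeff 0`, `y := N4(c₄,c₆,x,d) = 17424 d²⁰ 𝔠₄(t₁,1) ≠ 0` (P1, P2).  For `ℓ ∉ S₀`,
`𝔓 ∣ ℓ`, `φ` Frobenius fixing `t₁`: `x ≡ n (mod 𝔓)` (R2); `N6(c₄,c₆,x,d) = 240·17424·d³⁰𝔠₆(t₁,1) = 0`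
so `N6(c₄,c₆,n,d) ∈ 𝔓 ∩ ℤ = ℓℤ` (P3; `ZMod ℓ → ℤ̄/𝔓` injective), and `N4(c₄,c₆,n,d) ∉ ℓℤ` (R5);
`t := n · d⁻¹ (mod ℓ)` and homogeneity in `ZMod ℓ` (P2, P1). -/
theorem exists_int_root_mod (c₄ c₆ : ℤ) (t₁ : AlgebraicClosure ℚ)
    (h6 : C6 (c₄ : AlgebraicClosure ℚ) c₆ t₁ 1 = 0) (h4 : C4 (c₄ : AlgebraicClosure ℚ) c₆ t₁ 1 ≠ 0) :
    ∃ S₀ : Finset ℕ, ∀ (ℓ : ℕ) [Fact ℓ.Prime], ℓ ∉ S₀ →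
      ∀ {v : HeightOneSpectrum (𝓞 ℚ)}, (ℓ : 𝓞 ℚ) ∈ v.asIdeal →
      ∀ {𝔓 : Ideal (absIntegers (𝓞 ℚ) ℚ)}, 𝔓 ∈ v.primesAbove →
      ∀ {φ : Field.absoluteGaloisGroup ℚ}, IsArithFrobAt (𝓞 ℚ) φ 𝔓 → φ • t₁ = t₁ →
        ∃ t : ℤ, C6 (c₄ : ZMod ℓ) (c₆ : ZMod ℓ) (t : ZMod ℓ) 1 = 0 ∧
          C4 (c₄ : ZMod ℓ) (c₆ : ZMod ℓ) (t : ZMod ℓ) 1 ≠ 0 := by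
  sorry

/-- **G3 (PROVED from G3a, G3b, G3c)** — g4's `exists_prime_five_mod_twelve_root` verbatim. -/
theorem exists_prime_five_mod_twelve_root (c₄ c₆ : ℤ) (_hc : c₄ ^ 3 ≠ c₆ ^ 2)
    (t₁ ζ : AlgebraicClosure ℚ) (h6 : C6 (c₄ : AlgebraicClosure ℚ) c₆ t₁ 1 = 0)
    (h4 : C4 (c₄ : AlgebraicClosure ℚ) c₆ t₁ 1 ≠ 0) (hζ : IsPrimitiveRoot ζ 12)
    (σ : Field.absoluteGaloisGroup ℚ) (hσt : σ • t₁ = t₁) (hσζ : σ • ζ = ζ ^ 5) (S : Finset ℕ) :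
    ∃ (ℓ : ℕ) (_ : Fact ℓ.Prime), ℓ ∉ S ∧ ℓ % 12 = 5 ∧
      ∃ t : ℤ, C6 (c₄ : ZMod ℓ) (c₆ : ZMod ℓ) (t : ZMod ℓ) 1 = 0 ∧
        C4 (c₄ : ZMod ℓ) (c₆ : ZMod ℓ) (t : ZMod ℓ) 1 ≠ 0 := by
  obtain ⟨S₀, hS₀⟩ := exists_int_root_mod c₄ c₆ t₁ h6 h4
  obtain ⟨ℓ, hℓ, hℓS, v, hv, 𝔓, h𝔓, φ, hφ, hφt, hφζ⟩ :=
    exists_frob_fixing t₁ ζ σ hσt hσζ (S ∪ S₀ ∪ {2, 3})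
  simp only [Finset.mem_union, Finset.mem_insert, Finset.mem_singleton, not_or] at hℓS
  haveI : Fact ℓ.Prime := ⟨hℓ⟩
  obtain ⟨t, ht6, ht4⟩ := hS₀ ℓ hℓS.1.2 hv h𝔓 hφ hφt
  exact ⟨ℓ, ⟨hℓ⟩, hℓS.1.1, mod_twelve_of_frob hℓ hℓS.2.1 hℓS.2.2 hv h𝔓 hφ hζ hφζ, t, ht6, ht4⟩

/-! ## §4 T0 — the inertial element at `3`, as a recipe over named tree lemmas -/

/-- T0good (S): `E₁ : y² = x³ + x` has good reduction at the place of `ℚ` above `3`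
(`hasGoodReductionAt_of_valuation_le_one_of_valuation_Δ_eq_one`: coefficients `0, 1`; `Δ(E₁) = -64`,
`v(-64) = 1` by `Rat.valuation_intCast_eq_one_of_not_dvd` / `natGenerator v = 3`). [SilvermanAEC2009 VII.5.1(a)] -/
theorem hasGoodReductionAt_E₁ (v : HeightOneSpectrum (𝓞 ℚ)) (hv : ((3 : ℕ) : 𝓞 ℚ) ∈ v.asIdeal) :
    E₁.HasGoodReductionAt v := by
  sorry

/-- T0b (XS): if `τ` negates a square root of `3` and fixes `μ₄`, it negates every square root of `-3`
(`s = i s₃` with `i = s/s₃`, `i² = -1`). [folklore] -/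
theorem neg_sqrt_neg_three {τ : Field.absoluteGaloisGroup ℚ} {s₃ : AlgebraicClosure ℚ}
    (hs₃ : s₃ ^ 2 = 3) (hτ : τ • s₃ = -s₃) (hi : ∀ z : AlgebraicClosure ℚ, z ^ 4 = 1 → τ • z = z)
    (s : AlgebraicClosure ℚ) (hs : s ^ 2 = -3) : τ • s = -s := by
  sorry

/-- **T0 (S given T0good, T0b): an inertial element at `3`.**  Recipe: `v ∋ 3`
(`(primesEquiv).symm ⟨3,_⟩`, `natCast_mem_asIdeal_iff_eq_primesEquiv_symm`), `𝔓 ∈ v.primesAbove`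
(`primesAbove_nonempty`), `s₃² = 3` (`IsAlgClosed.exists_pow_nat_eq`), `τ₀ ∈ I_𝔓` with `τ₀ s₃ = -s₃`
(`exists_mem_inertia_smul_eq_neg_of_sq_eq_prime Nat.prime_three`); `χ₂₀(τ₀) = 1`
(`Rat.modNCyclotomicCharacter_eq_one_of_mem_inertia`, `¬ 3 ∣ 20`) so `τ₀ z = z` for `z²⁰ = 1`
(`modNCyclotomicCharacter_spec`); T0b; `E₁[5]` fixed by `I_𝔓`
(`smul_geomTorsion_eq_of_mem_inertia (hasGoodReductionAt_E₁ v hv)` with `(5 : 𝓞 ℚ) ∉ v`).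
[SilvermanAEC2009 VII.4.1; NeukirchANT1999 I §9] -/
theorem exists_inertial_elt :
    ∃ τ₀ : Field.absoluteGaloisGroup ℚ,
      (∀ s : AlgebraicClosure ℚ, s ^ 2 = -3 → τ₀ • s = -s) ∧
      (∀ z : AlgebraicClosure ℚ, z ^ 20 = 1 → τ₀ • z = z) ∧
      ∀ P : E₁.geomTorsion 5, τ₀ • P = P := by
  sorry

/-! ## §5 F2 cut (the order-8 certificate; shared with k1's line) -/

/-- **F2b (S, finite): in `GL₂(𝔽₃)`, `det g = −1` and `tr g ≠ 0` force `orderOf g = 8`.**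
`charpoly = X² ∓ X − 1` is irreducible over `𝔽₃` with roots of order `8` in `𝔽₉ˣ` (`α⁴ = −1`);
in Lean: `g ^ 4 = -1` by Cayley–Hamilton (`Matrix.pow_two_eq_trace_smul_sub_det_smul`… or
`fin_cases` on the four entries + `decide`), then `orderOf_eq_prime_pow`-style bookkeeping. [Serre1972 §2.5; folklore] -/
theorem orderOf_eq_eight_of_det_eq_neg_one (g : GL (Fin 2) (ZMod 3))
    (htr : Matrix.trace (g : Matrix (Fin 2) (Fin 2) (ZMod 3)) ≠ 0)
    (hdet : Matrix.GeneralLinearGroup.det g = -1) : orderOf g = 8 := by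
  sorry

/-- **F2a (S): an ordinary Frobenius of order `8` mod `3`.**  `v ∋ q`, `𝔓 ∣ v`, `φ` Frobenius
(`exists_isArithFrobAt_of_mem_primesAbove_holds`); through the frame `e` of `hρ`,
`tr ρ(φ) = a_q (mod 3) ≠ 0` and `det ρ(φ) = q ≡ −1 (mod 3)` (tree PROVED
`trace_galoisRepTorsion_frobenius_eq`, `det_galoisRepTorsion_frobenius_eq`, transport as in
`Theorems.exists_orderOf_eq_eight_of_dvd_frobeniusTrace`); F2b. [Serre1972 §2.8; ConradDiamondTaylor1999 p. 556] -/
theorem exists_orderOf_eq_eight_of_not_dvd_frobeniusTrace (W : WeierstrassCurve ℚ) [W.IsElliptic]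
    [W.IsGloballyMinimal] (q : ℕ) [Fact q.Prime] (hq : q % 3 = 2)
    (hgood : W.HasGoodReductionAtPrime q) (ha : ¬ (3 : ℤ) ∣ W.frobeniusTrace q)
    {ρ : ModPGaloisRep ℚ (ZMod 3) 2} (hρ : W.IsTorsionGaloisRep 3 ρ) :
    ∃ σ : Field.absoluteGaloisGroup ℚ, orderOf (ρ σ) = 8 := by
  sorry

/-- **F2 = g4's `FrobeniusCertificate`, PROVED from F2a** + tree PROVED
`det_eq_modPCyclotomicCharacter_of_isTorsionGaloisRep_holds` +
`Theorems.isAbsIrreducibleOverSqrt_negThree_of_orderOf_eq_eight`. -/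
theorem frobeniusCertificate :
    ∀ (W : WeierstrassCurve ℚ) [W.IsElliptic] [W.IsGloballyMinimal] (q : ℕ) [Fact q.Prime],
      q % 3 = 2 → W.HasGoodReductionAtPrime q → ¬ (3 : ℤ) ∣ W.frobeniusTrace q →
      ∀ ρ₃ : ModPGaloisRep ℚ (ZMod 3) 2, W.IsTorsionGaloisRep 3 ρ₃ → ρ₃.IsAbsIrreducibleOverSqrt (-3) := by
  intro W _ _ q _ hq hgood ha ρ₃ hρ
  obtain ⟨σ, h8⟩ := exists_orderOf_eq_eight_of_not_dvd_frobeniusTrace W q hq hgood ha hρ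
  haveI : Fact (Nat.Prime 3) := ⟨Nat.prime_three⟩
  exact Summit.ABC.ABC.Theorems.isAbsIrreducibleOverSqrt_negThree_of_orderOf_eq_eight ρ₃
    (W.det_eq_modPCyclotomicCharacter_of_isTorsionGaloisRep_holds 3 ρ₃ hρ) h8

/-! ## sanity: the stub is literally the route's named fact -/
example : CDT_three_five_switch ↔
    (∀ (W : WeierstrassCurve ℚ) [W.IsElliptic], ¬ 27 ∣ W.conductorNorm ℤ →
      (∀ ρ₃ : ModPGaloisRep ℚ (ZMod 3) 2, W.IsTorsionGaloisRep 3 ρ₃ → ¬ ρ₃.IsAbsIrreducibleOverSqrt (-3)) →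
      ∀ (ρ : ModPGaloisRep ℚ (ZMod 5) 2), W.IsTorsionGaloisRep 5 ρ → ρ.IsAbsIrreducibleOverSqrt 5 →
        ∃ (W' : WeierstrassCurve ℚ) (_ : W'.IsElliptic), W'.IsTorsionGaloisRep 5 ρ ∧
          ∃ ρ₃' : ModPGaloisRep ℚ (ZMod 3) 2, W'.IsTorsionGaloisRep 3 ρ₃' ∧
            ρ₃'.IsAbsIrreducibleOverSqrt (-3)) := Iff.rfl

end Summit.ABC.ABC.Cruxes.FreyModularity.StubSwitchK3g5

end
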